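import Literature.Analysis.Complex.WeakHolomorphy
import Literature.Analysis.Complex.OsgoodSeparate
import Mathlib.Analysis.InnerProductSpace.Calculus
import Mathlib.Analysis.Calculus.FDeriv.RestrictScalars
import Mathlib.Topology.Algebra.Module.Star
import HarnessLib

/-!
# Sesqui-holomorphic pairings: `⟪Ψ₁(w̄), T(τ) Ψ₂(z)⟫` is jointly holomorphic

Analysis/Complex support file (everything proved; no definitions, no named facts). The holomorphy
statement behind the step **(P_{N-1}) ⇒ (A_N)** of Osterwalder–Schrader, *Axioms for Euclidean
Green's functions II*, Comm. Math. Phys. 42 (1975), Ch. V.2, p. 294: *"By (P_{M-1}) we can define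
`S_k(θζ', x' + x + τ, ζ) = (Ψₙ(x', ζ'), e^{-τH} Ψₘ(x, ζ))` … this analytically extends `S_k`"* —
the matrix element of a (weakly) holomorphic semigroup between a holomorphic vector-valued map of
`ζ` and the complex conjugate coordinates of a holomorphic vector-valued map of `ζ'` is a jointly
holomorphic function of `(ζ̄', τ, ζ)`.

* `differentiableAt_inner_of_conjLinear_fderiv` — if `Ψ` is real-differentiable at `x` with a
  *conjugate-linear* derivative and `G` is complex-differentiable at `x` (both `H`-valued on a
  complex normed space), then `p ↦ ⟪Ψ p, G p⟫` is complex-differentiable at `x` (its real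
  derivative `h ↦ ⟪Ψ x, DG h⟫ + ⟪DΨ h, G x⟫` is complex-linear).
* `hasFDerivAt_comp_star` — `p ↦ Ψ₁ (star (A p))` (`A` complex-linear, `Ψ₁` holomorphic,
  `star` = coordinatewise conjugation on `ℂᵐ`) is real-differentiable with conjugate-linear
  derivative.
* `differentiableOn_inner_star` — `(w, z) ↦ ⟪Ψ₁ (star w), Ψ₂ z⟫` is jointly holomorphic
  (the Gram kernels `S_{n+m-1}(θζ', x' + x, ζ)` of OS II (5.17)).
* `differentiableOn_clm_apply_of_weakly_holomorphic` — for an operator family `T` on a Hilbert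
  space, weakly holomorphic (`τ ↦ ⟪x, T τ y⟫` holomorphic) and bounded on an open `S`, and `Ψ₂`
  holomorphic: `(τ, z) ↦ T τ (Ψ₂ z)` is jointly holomorphic (`H`-valued; Dunford + Osgood).
* `differentiableOn_inner_star_semigroup` — **the generating function of (A_N)**:
  `(w, τ, z) ↦ ⟪Ψ₁ (star w), T τ (Ψ₂ z)⟫` is jointly holomorphic on
  `{star w ∈ U₁} × S × U₂`.

## References

* K. Osterwalder, R. Schrader, *Axioms for Euclidean Green's functions II*, Comm. Math. Phys. 42
  (1975) 281–305, Ch. V.2 p. 294 ((P_{M-1}) ⇒ (A_M)) and (5.17). [OsterwalderSchraderCMP1975]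
-/

noncomputable section

open Metric Set Filter Complex
open scoped Topology ComplexConjugate InnerProductSpace

namespace Literature.Analysis.Complex

variable {X : Type*} [NormedAddCommGroup X] [NormedSpace ℂ X]
variable {H : Type*} [NormedAddCommGroup H] [InnerProductSpace ℂ H]

/-! ### Pairing a conjugate-differentiable map with a differentiable one -/

/-- **Sesquilinear pairings of an antiholomorphic and a holomorphic map are holomorphic.** If
`Ψ : X → H` has at `x` a real Fréchet derivative `DΨ` which is conjugate-linear, and `G : X → H`
has a complex derivative `DG` at `x`, then `p ↦ ⟪Ψ p, G p⟫` is complex-differentiable at `x`: its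
real derivative `h ↦ ⟪Ψ x, DG h⟫ + ⟪DΨ h, G x⟫` is complex-linear (conjugate-linear twice in
the second term). [folklore] -/
theorem differentiableAt_inner_of_conjLinear_fderiv {Ψ G : X → H} {x : X} {DΨ : X →L[ℝ] H}
    {DG : X →L[ℂ] H} (hΨ : HasFDerivAt Ψ DΨ x)
    (hconj : ∀ (c : ℂ) (h : X), DΨ (c • h) = conj c • DΨ h) (hG : HasFDerivAt G DG x) :
    DifferentiableAt ℂ (fun p => ⟪Ψ p, G p⟫_ℂ) x := by
  have hR : HasFDerivAt (fun p => ⟪Ψ p, G p⟫_ℂ)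
      ((fderivInnerCLM ℂ (Ψ x, G x)).comp (DΨ.prod (DG.restrictScalars ℝ))) x :=
    hΨ.inner ℂ (hG.restrictScalars ℝ)
  -- the complex-linear candidate
  let L : X →L[ℂ] ℂ :=
    { toFun := fun h => ⟪Ψ x, DG h⟫_ℂ + ⟪DΨ h, G x⟫_ℂ
      map_add' := fun h h' => by
        simp only [map_add, inner_add_right, inner_add_left]; abel
      map_smul' := fun c h => by
        simp only [map_smul, hconj, inner_smul_right, inner_smul_left, Complex.conj_conj,
          RingHom.id_apply, smul_eq_mul]
        ring
      cont := by
        refine Continuous.add ?_ ?_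
        · exact (innerSL ℂ (Ψ x)).continuous.comp DG.continuous
        · have : Continuous fun h => ⟪DΨ h, G x⟫_ℂ :=
            Continuous.inner DΨ.continuous continuous_const
          exact this }
  have hL : L.restrictScalars ℝ = (fderivInnerCLM ℂ (Ψ x, G x)).comp (DΨ.prod (DG.restrictScalars ℝ)) := by
    ext h
    simp [L, fderivInnerCLM_apply]
  exact (hasFDerivAt_of_restrictScalars ℝ hR hL).differentiableAt

/-! ### Composing with coordinatewise conjugation -/

section Star

variable {m : ℕ} {F : Type*} [NormedAddCommGroup F] [NormedSpace ℂ F]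

/-- Coordinatewise conjugation on `ℂᵐ` as a real continuous linear map is `star`. [folklore] -/
theorem starL'_real_apply (v : Fin m → ℂ) :
    (starL' ℝ : (Fin m → ℂ) ≃L[ℝ] (Fin m → ℂ)) v = star v := by
  simp

/-- `star` on `ℂᵐ` is conjugate-linear. [folklore] -/
theorem star_smul_pi (c : ℂ) (v : Fin m → ℂ) : star (c • v) = conj c • star v := by
  funext i; simp

/-- **`p ↦ Ψ₁ (star (A p))` is conjugate-differentiable**: for `A : X →L[ℂ] ℂᵐ` and `Ψ₁`
complex-differentiable at `star (A x)`, the map has the real derivative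
`h ↦ DΨ₁ (star (A h))`. [folklore] -/
theorem hasFDerivAt_comp_star {Ψ₁ : (Fin m → ℂ) → F} (A : X →L[ℂ] (Fin m → ℂ)) {x : X}
    (hΨ : DifferentiableAt ℂ Ψ₁ (star (A x))) :
    HasFDerivAt (fun p => Ψ₁ (star (A p)))
      (((fderiv ℂ Ψ₁ (star (A x))).restrictScalars ℝ).comp
        (((starL' ℝ : (Fin m → ℂ) ≃L[ℝ] (Fin m → ℂ)) : (Fin m → ℂ) →L[ℝ] (Fin m → ℂ)).comp
          (A.restrictScalars ℝ))) x := by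
  have hA : HasFDerivAt (fun p => A p) (A.restrictScalars ℝ) x := (A.hasFDerivAt).restrictScalars ℝ
  have hfun : (fun v : Fin m → ℂ => star v) = ⇑(starL' ℝ : (Fin m → ℂ) ≃L[ℝ] (Fin m → ℂ)) := by
    funext v; simp
  have hstar : HasFDerivAt (fun v : Fin m → ℂ => star v)
      ((starL' ℝ : (Fin m → ℂ) ≃L[ℝ] (Fin m → ℂ)) : (Fin m → ℂ) →L[ℝ] (Fin m → ℂ)) (A x) := by
    rw [hfun]; exact (starL' ℝ : (Fin m → ℂ) ≃L[ℝ] (Fin m → ℂ)).hasFDerivAt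
  have hΨR : HasFDerivAt Ψ₁ ((fderiv ℂ Ψ₁ (star (A x))).restrictScalars ℝ) (star (A x)) :=
    hΨ.hasFDerivAt.restrictScalars ℝ
  exact hΨR.comp x (hstar.comp x hA)

/-- … and that real derivative is conjugate-linear. [folklore] -/
theorem comp_star_fderiv_conjLinear {Ψ₁ : (Fin m → ℂ) → F} (A : X →L[ℂ] (Fin m → ℂ)) (x : X)
    (c : ℂ) (h : X) :
    (((fderiv ℂ Ψ₁ (star (A x))).restrictScalars ℝ).comp
        (((starL' ℝ : (Fin m → ℂ) ≃L[ℝ] (Fin m → ℂ)) : (Fin m → ℂ) →L[ℝ] (Fin m → ℂ)).comp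
          (A.restrictScalars ℝ))) (c • h) =
      conj c • (((fderiv ℂ Ψ₁ (star (A x))).restrictScalars ℝ).comp
        (((starL' ℝ : (Fin m → ℂ) ≃L[ℝ] (Fin m → ℂ)) : (Fin m → ℂ) →L[ℝ] (Fin m → ℂ)).comp
          (A.restrictScalars ℝ))) h := by
  simp only [ContinuousLinearMap.comp_apply, ContinuousLinearMap.coe_restrictScalars',
    ContinuousLinearEquiv.coe_coe, starL'_real_apply, map_smul, star_smul_pi]

/-- **`⟪Ψ₁ (star (A p)), G p⟫` is holomorphic** where `Ψ₁` is holomorphic at the points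
`star (A p)` and `G` is holomorphic. [folklore] -/
theorem differentiableOn_inner_star_comp {Ψ₁ : (Fin m → ℂ) → H} {G : X → H}
    (A : X →L[ℂ] (Fin m → ℂ)) {W : Set X} (hΨ : ∀ p ∈ W, DifferentiableAt ℂ Ψ₁ (star (A p)))
    (hG : ∀ p ∈ W, DifferentiableAt ℂ G p) :
    DifferentiableOn ℂ (fun p => ⟪Ψ₁ (star (A p)), G p⟫_ℂ) W := fun p hp =>
  (differentiableAt_inner_of_conjLinear_fderiv (hasFDerivAt_comp_star A (hΨ p hp))
    (comp_star_fderiv_conjLinear A p) (hG p hp).hasFDerivAt).differentiableWithinAt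

/-- **Gram kernels `(w, z) ↦ ⟪Ψ₁ (star w), G z⟫` are jointly holomorphic** (OS II (5.17):
`S_{n+m-1}(θζ', x' + x, ζ) = (Ψₙ(x', ζ'), Ψₘ(x, ζ))`, holomorphic in `(ζ̄', ζ)`), for `Ψ₁`
holomorphic on an open `U₁ ⊆ ℂᵐ` and `G` holomorphic on an open `V`. [cite: OsterwalderSchraderCMP1975, Ch. V.2 (5.17)] -/
theorem differentiableOn_inner_star_prod {Y : Type*} [NormedAddCommGroup Y] [NormedSpace ℂ Y]
    {Ψ₁ : (Fin m → ℂ) → H} {G : Y → H} {U₁ : Set (Fin m → ℂ)} {V : Set Y} (hU₁ : IsOpen U₁)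
    (hV : IsOpen V) (h₁ : DifferentiableOn ℂ Ψ₁ U₁) (hG : DifferentiableOn ℂ G V) :
    DifferentiableOn ℂ (fun p : (Fin m → ℂ) × Y => ⟪Ψ₁ (star p.1), G p.2⟫_ℂ)
      {p | star p.1 ∈ U₁ ∧ p.2 ∈ V} := by
  have h := differentiableOn_inner_star_comp (X := (Fin m → ℂ) × Y) (Ψ₁ := Ψ₁) (G := fun p => G p.2)
    (ContinuousLinearMap.fst ℂ (Fin m → ℂ) Y) (W := {p | star p.1 ∈ U₁ ∧ p.2 ∈ V})
    (fun p hp => h₁.differentiableAt (hU₁.mem_nhds hp.1))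
    (fun p hp => (hG.differentiableAt (hV.mem_nhds hp.2)).comp p differentiableAt_snd)
  simpa only [ContinuousLinearMap.coe_fst'] using h

end Star

/-! ### Weakly holomorphic operator families applied to holomorphic vectors -/

section Semigroup

variable [CompleteSpace H] {m₂ : ℕ}

/-- A weakly holomorphic, bounded operator family is strongly holomorphic on each vector
(Dunford; `differentiableOn_of_forall_inner`). [folklore] -/
theorem differentiableOn_clm_apply_vec {T : ℂ → H →L[ℂ] H} {S : Set ℂ} (hS : IsOpen S)
    (hTw : ∀ x y : H, DifferentiableOn ℂ (fun τ => ⟪x, T τ y⟫_ℂ) S)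
    (hTb : ∃ C : ℝ, ∀ τ ∈ S, ‖T τ‖ ≤ C) (v : H) :
    DifferentiableOn ℂ (fun τ => T τ v) S := by
  obtain ⟨C, hC⟩ := hTb
  refine differentiableOn_of_forall_inner hS (fun z₀ hz₀ => ?_) fun x => hTw x v
  obtain ⟨r, hr, hball⟩ := Metric.isOpen_iff.1 hS z₀ hz₀
  exact ⟨r, hr, C * ‖v‖, fun z hz => ((T z).le_opNorm v).trans
    (mul_le_mul_of_nonneg_right (hC z (hball hz)) (norm_nonneg v))⟩

/-- **`(τ, z) ↦ T τ (Ψ₂ z)` is jointly holomorphic** (`H`-valued) for a weakly holomorphic bounded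
operator family `T` on an open `S ⊆ ℂ` and `Ψ₂` holomorphic on an open `U₂ ⊆ ℂᵐ` (strong
holomorphy in `τ` by Dunford's theorem, joint continuity by the uniform bound, then Osgood's
lemma in the two blocks). [folklore] -/
theorem differentiableOn_clm_apply_of_weakly_holomorphic {T : ℂ → H →L[ℂ] H} {S : Set ℂ}
    (hS : IsOpen S) (hTw : ∀ x y : H, DifferentiableOn ℂ (fun τ => ⟪x, T τ y⟫_ℂ) S)
    (hTb : ∃ C : ℝ, ∀ τ ∈ S, ‖T τ‖ ≤ C) {Ψ₂ : (Fin m₂ → ℂ) → H} {U₂ : Set (Fin m₂ → ℂ)}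
    (hU₂ : IsOpen U₂) (h₂ : DifferentiableOn ℂ Ψ₂ U₂) :
    DifferentiableOn ℂ (fun q : ℂ × (Fin m₂ → ℂ) => T q.1 (Ψ₂ q.2)) (S ×ˢ U₂) := by
  have hTv := differentiableOn_clm_apply_vec hS hTw hTb
  obtain ⟨C, hC⟩ := hTb
  have hC0 : ∀ τ ∈ S, 0 ≤ C := fun τ hτ => (norm_nonneg _).trans (hC τ hτ)
  -- joint continuity
  have hcont : ContinuousOn (fun q : ℂ × (Fin m₂ → ℂ) => T q.1 (Ψ₂ q.2)) (S ×ˢ U₂) := by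
    rintro ⟨τ₀, z₀⟩ ⟨hτ₀, hz₀⟩
    set v₀ := Ψ₂ z₀ with hv₀
    have hΨc : ContinuousWithinAt (fun q : ℂ × (Fin m₂ → ℂ) => Ψ₂ q.2) (S ×ˢ U₂) (τ₀, z₀) :=
      ((h₂.continuousOn.continuousAt (hU₂.mem_nhds hz₀)).comp continuousAt_snd).continuousWithinAt
    have hTc : ContinuousWithinAt (fun q : ℂ × (Fin m₂ → ℂ) => T q.1 v₀) (S ×ˢ U₂) (τ₀, z₀) :=
      (((hTv v₀).continuousOn.continuousAt (hS.mem_nhds hτ₀)).comp continuousAt_fst).continuousWithinAt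
    rw [ContinuousWithinAt, tendsto_iff_norm_sub_tendsto_zero]
    have hbound : ∀ q ∈ S ×ˢ U₂, ‖T q.1 (Ψ₂ q.2) - T τ₀ (Ψ₂ z₀)‖ ≤
        C * ‖Ψ₂ q.2 - v₀‖ + ‖T q.1 v₀ - T τ₀ v₀‖ := by
      rintro ⟨τ, z⟩ ⟨hτ, _⟩
      have e : T τ (Ψ₂ z) - T τ₀ (Ψ₂ z₀) = T τ (Ψ₂ z - v₀) + (T τ v₀ - T τ₀ v₀) := by
        rw [map_sub]; simp only [hv₀]; abel
      rw [e]
      refine (norm_add_le _ _).trans (add_le_add ?_ le_rfl)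
      exact ((T τ).le_opNorm _).trans (mul_le_mul_of_nonneg_right (hC τ hτ) (norm_nonneg _))
    have hlim : Tendsto (fun q : ℂ × (Fin m₂ → ℂ) => C * ‖Ψ₂ q.2 - v₀‖ + ‖T q.1 v₀ - T τ₀ v₀‖)
        (𝓝[S ×ˢ U₂] (τ₀, z₀)) (𝓝 0) := by
      have h1 : Tendsto (fun q : ℂ × (Fin m₂ → ℂ) => ‖Ψ₂ q.2 - v₀‖) (𝓝[S ×ˢ U₂] (τ₀, z₀)) (𝓝 0) := by
        have := (tendsto_iff_norm_sub_tendsto_zero.1 hΨc.tendsto)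
        simpa [hv₀] using this
      have h2 : Tendsto (fun q : ℂ × (Fin m₂ → ℂ) => ‖T q.1 v₀ - T τ₀ v₀‖) (𝓝[S ×ˢ U₂] (τ₀, z₀)) (𝓝 0) :=
        tendsto_iff_norm_sub_tendsto_zero.1 hTc.tendsto
      simpa using (h1.const_mul C).add h2
    refine squeeze_zero_norm' ?_ hlim
    filter_upwards [self_mem_nhdsWithin] with q hq
    rw [norm_norm]
    exact hbound q hq
  -- Osgood in the two blocks
  refine SCV.differentiableOn_prod_of_separately (hS.prod hU₂) hcont (fun q hq => ?_) (fun t => ?_)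
  · exact (hTv (Ψ₂ q.2)).differentiableAt (hS.mem_nhds hq.1)
  · exact (T t).differentiable.comp_differentiableOn (h₂.mono fun p hp => hp.2)

/-- **The generating function of the step (A_N) of Osterwalder–Schrader II is jointly
holomorphic**: for `Ψ₁, Ψ₂` holomorphic `H`-valued on open sets `U₁ ⊆ ℂ^{m₁}`, `U₂ ⊆ ℂ^{m₂}` and a
weakly holomorphic bounded operator family `T` on an open `S ⊆ ℂ` (e.g. `e^{-τH}` on
`{Re τ > 0}`), the function `(w, τ, z) ↦ ⟪Ψ₁ (star w), T τ (Ψ₂ z)⟫` is holomorphic on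
`{(w, τ, z) | star w ∈ U₁, τ ∈ S, z ∈ U₂}` (OS II p. 294: "`S_k(θζ', x' + x + τ, ζ) =
(Ψₙ(x', ζ'), e^{-τH} Ψₘ(x, ζ))` … analytically extends `S_k`"). [cite: OsterwalderSchraderCMP1975, Ch. V.2 p. 294] -/
theorem differentiableOn_inner_star_semigroup {m₁ : ℕ} {T : ℂ → H →L[ℂ] H} {S : Set ℂ}
    (hS : IsOpen S) (hTw : ∀ x y : H, DifferentiableOn ℂ (fun τ => ⟪x, T τ y⟫_ℂ) S)
    (hTb : ∃ C : ℝ, ∀ τ ∈ S, ‖T τ‖ ≤ C)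
    {Ψ₁ : (Fin m₁ → ℂ) → H} {U₁ : Set (Fin m₁ → ℂ)} (hU₁ : IsOpen U₁) (h₁ : DifferentiableOn ℂ Ψ₁ U₁)
    {Ψ₂ : (Fin m₂ → ℂ) → H} {U₂ : Set (Fin m₂ → ℂ)} (hU₂ : IsOpen U₂) (h₂ : DifferentiableOn ℂ Ψ₂ U₂) :
    DifferentiableOn ℂ
      (fun p : (Fin m₁ → ℂ) × ℂ × (Fin m₂ → ℂ) => ⟪Ψ₁ (star p.1), T p.2.1 (Ψ₂ p.2.2)⟫_ℂ)
      {p | star p.1 ∈ U₁ ∧ p.2.1 ∈ S ∧ p.2.2 ∈ U₂} := by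
  have hG := differentiableOn_clm_apply_of_weakly_holomorphic hS hTw hTb hU₂ h₂
  have h := differentiableOn_inner_star_prod (Y := ℂ × (Fin m₂ → ℂ)) hU₁ (hS.prod hU₂) h₁ hG
  have hset : {p : (Fin m₁ → ℂ) × ℂ × (Fin m₂ → ℂ) | star p.1 ∈ U₁ ∧ p.2.1 ∈ S ∧ p.2.2 ∈ U₂} =
      {p | star p.1 ∈ U₁ ∧ p.2 ∈ S ×ˢ U₂} := by
    ext p; simp only [Set.mem_setOf_eq, Set.mem_prod]
  rw [hset]
  exact h

end Semigroup

end Literature.Analysis.Complex
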